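import Summits.BirchSwinnertonDyer.BirchSwinnertonDyer.Theorems.BiquadraticEisensteinDescentHeegnerTwistCouplingInSupplyQuarticPartnerEuler
import HarnessLib

set_option linter.dupNamespace false -- `Summit.BirchSwinnertonDyer.BirchSwinnertonDyer.Theorems.…` (summit = sub)
set_option autoImplicit false

/-!
# Crux `HeegnerTwistCouplingInSupply` (stmt-BirchSwinnertonDyer-21381) — the QUARTIC `j = 1728` corner with a SYMBOLIC PARTNER, II:
# the dual side `S(0, 4r²pq²) = {1, p}` (`r ≡ 5 (mod 8)`, `(r/p) = +1`, `p ∉ 𝔽_r^{×4}`)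

Route `BiquadraticEisensteinDescent` (cell `pub/bsd-wall`, width seat `bsd-wall-cm-bed-w4` g13; `--supports` 21381, helper).
Continuation of `…QuarticPartnerDescent`: descent on the divisors of `b′ = 4r²pq²` for `E = W_p⁻^{(−rq)} : y² = x³ − r²pq²·x`
(Silverman's `S^{(φ)}(E/ℚ)`), ★ `mem_selmer_pos_iff`: `S(0, 4r²pq²) = {1, p}`. Of the thirty-two squarefree divisors the sixteen
negative ones die over `ℝ`; `1`, `p` are the images of `O`, `T`; `q, pq, rq, rpq, 2q, 2pq, 2rq, 2rpq` die at `p`; `2, 2p` die at `r`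
(`2 ∉ 𝔽_r^{×2}` as `r ≡ 5 (mod 8)`); `r, rp` die at `r` and `2r, 2rp` at `q` when `(q/r) = +1`, the other way round when `(q/r) = −1`.
The kills at `r` rest on EULER'S CRITERION for `r = 8k + 5`: a non-residue `a` has `(a^{k+1})⁴ = −a²`, so `−4q² = ((2q)^{k+1})⁴`
when `(q/r) = +1` and `−q² = (q^{k+1})⁴` when `(q/r) = −1`, reducing each reduced form to `x⁴ = p·z⁴`, impossible for `p ∉ 𝔽_r^{×4}`;
quadratic reciprocity gives `(p/r) = (r/p) = +1` and `(r/q) = (q/r)`. Numerics (crux memo QUARTIC-CORNER-w4g13.md): sharp iff `p ∉ 𝔽_r^{×4}`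
for `r ∈ {5, 13, 29, 37, 53, 61}`, no exception.

HONEST FRAMING: a typed sub-corner on one CM family (measure zero in «all CM `W`»); the crux (residual C⁺) is untouched; BSD is not
proved by any of this. THEOREMS ONLY (no `def`, no named fact, no sorry). Supports stmt-BirchSwinnertonDyer-21381.
-/

noncomputable section

open scoped Classical

namespace Summit.BirchSwinnertonDyer.BirchSwinnertonDyer.Theorems.BiquadraticEisensteinDescentHeegnerTwistCouplingInSupplyQuarticPartnerDescentDual

open Literature.NumberTheory.EllipticCurves Literature.NumberTheory.EllipticCurves.XCubeAddPX
  Summit.BirchSwinnertonDyer.BirchSwinnertonDyer.Theorems.BiquadraticEisensteinDescentHeegnerTwistCouplingInSupplyQuarticTwistLocal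
  Summit.BirchSwinnertonDyer.BirchSwinnertonDyer.Theorems.BiquadraticEisensteinDescentHeegnerTwistCouplingInSupplyQuarticTwistDescent
  Summit.BirchSwinnertonDyer.BirchSwinnertonDyer.Theorems.BiquadraticEisensteinDescentHeegnerTwistCouplingInSupplyQuarticTwistDescentDual
  Summit.BirchSwinnertonDyer.BirchSwinnertonDyer.Theorems.BiquadraticEisensteinDescentHeegnerTwistCouplingInSupplyQuarticPartnerDescent
  Summit.BirchSwinnertonDyer.BirchSwinnertonDyer.Theorems.BiquadraticEisensteinDescentHeegnerTwistCouplingInSupplyQuarticPartnerEuler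

/-! ## §3 The side `S(0, 4r²pq²) = {1, p}` -/

section Dual

variable {p q r : ℕ} [hp : Fact p.Prime] [hq : Fact q.Prime] [hr : Fact r.Prime]

/-- The squarefree divisors of `4·r²·p·q²`: absolute values among `{1,2}·{1,r}·{1,p}·{1,q}`. [folklore] -/
theorem natAbs_eq_of_squarefree_dvd_partner' {d : ℤ} (hsq : Squarefree d) (hdvd : d ∣ (4 * r ^ 2 * p * q ^ 2 : ℤ)) :
    (d.natAbs = 1 ∨ d.natAbs = 2 ∨ d.natAbs = r ∨ d.natAbs = 2 * r) ∨
    (d.natAbs = p ∨ d.natAbs = 2 * p ∨ d.natAbs = r * p ∨ d.natAbs = 2 * r * p) ∨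
    (d.natAbs = q ∨ d.natAbs = 2 * q ∨ d.natAbs = r * q ∨ d.natAbs = 2 * r * q) ∨
    (d.natAbs = p * q ∨ d.natAbs = 2 * (p * q) ∨ d.natAbs = r * (p * q) ∨ d.natAbs = 2 * r * (p * q)) := by
  set m := d.natAbs with hm_def
  have hmsq : Squarefree m := Int.squarefree_natAbs.mpr hsq
  have hm1 : m ∣ 4 * r ^ 2 * p * q ^ 2 := by
    have h1 := Int.natAbs_dvd_natAbs.mpr hdvd
    have h2 : (4 * r ^ 2 * p * q ^ 2 : ℤ).natAbs = 4 * r ^ 2 * p * q ^ 2 := by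
      rw [show (4 * r ^ 2 * p * q ^ 2 : ℤ) = ((4 * r ^ 2 * p * q ^ 2 : ℕ) : ℤ) by push_cast; ring, Int.natAbs_natCast]
    rwa [h2] at h1
  have hm2 : m ∣ (2 * r * (p * q)) ^ 2 := dvd_trans hm1 ⟨p, by ring⟩
  have hm3 : m ∣ 2 * r * (p * q) := (hmsq.dvd_pow_iff_dvd two_ne_zero).mp hm2
  obtain ⟨a, b, ha, hb, hm⟩ := exists_dvd_and_dvd_of_dvd_mul hm3
  obtain ⟨a₁, a₂, ha₁, ha₂, rfl⟩ := exists_dvd_and_dvd_of_dvd_mul ha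
  obtain ⟨b₁, b₂, hb₁, hb₂, rfl⟩ := exists_dvd_and_dvd_of_dvd_mul hb
  rcases (Nat.dvd_prime Nat.prime_two).mp ha₁ with h1 | h1 <;>
  rcases (Nat.dvd_prime hr.out).mp ha₂ with h2 | h2 <;>
  rcases (Nat.dvd_prime hp.out).mp hb₁ with h3 | h3 <;>
  rcases (Nat.dvd_prime hq.out).mp hb₂ with h4 | h4 <;>
  · rw [hm, h1, h2, h3, h4]; simp

/-- ★ **`S(0, 4r²pq²) = {1, p}`** for primes `p ≡ 7 (mod 8)`, `q ≡ 3 (mod 8)`, `r ≡ 5 (mod 8)` with `(q/p) = −1`, `(r/p) = +1` and `p` not a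
fourth power modulo `r`: descent on the divisors of `b′ = 4r²pq²` (Silverman's `S^{(φ)}(E/ℚ)` for `E : y² = x³ − r²pq²x`).
[cite: SilvermanAEC2009, Prop. X.4.9 and Prop. X.6.1] -/
theorem mem_selmer_pos_iff (hp8 : p % 8 = 7) (hq8 : q % 8 = 3) (hr8 : r % 8 = 5)
    (hnq : ¬ IsSquare ((q : ℤ) : ZMod p)) (hsr : IsSquare ((r : ℤ) : ZMod p))
    (hp4 : ∀ t : ZMod r, t ^ 4 ≠ ((p : ℤ) : ZMod r)) (d : ℤ) :
    d ∈ twoIsogenySelmerGroup 0 (4 * r ^ 2 * p * q ^ 2 : ℤ) ↔ d = 1 ∨ d = (p : ℤ) := by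
  have hP := hp.out
  have hQ := hq.out
  have hR := hr.out
  have hqp : q ≠ p := by rintro rfl; omega
  have hrp : r ≠ p := by rintro rfl; omega
  have hrq : r ≠ q := by rintro rfl; omega
  have hq2 : q ≠ 2 := by rintro rfl; omega
  have hp0 : (p : ℤ) ≠ 0 := by exact_mod_cast hP.ne_zero
  have hq0 : (q : ℤ) ≠ 0 := by exact_mod_cast hQ.ne_zero
  have hr0 : (r : ℤ) ≠ 0 := by exact_mod_cast hR.ne_zero
  have hbpos : (0 : ℤ) < 4 * r ^ 2 * p * q ^ 2 := by positivity
  have hb : (4 * r ^ 2 * p * q ^ 2 : ℤ) ≠ 0 := hbpos.ne'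
  have hpq : ¬ (p : ℤ) ∣ q := fun h => hqp (((Nat.prime_dvd_prime_iff_eq hP hQ).mp (by exact_mod_cast h))).symm
  have hpr : ¬ (p : ℤ) ∣ r := fun h => hrp (((Nat.prime_dvd_prime_iff_eq hP hR).mp (by exact_mod_cast h))).symm
  have hp2' : ¬ (p : ℤ) ∣ 2 := fun h => by
    have h' : p ∣ 2 := by exact_mod_cast h
    rcases (Nat.dvd_prime Nat.prime_two).mp h' with h'' | h'' <;> omega
  have hpI : Prime (p : ℤ) := Nat.prime_iff_prime_int.mp hP
  have hnd : ∀ m : ℤ, ¬ (p : ℤ) ∣ m → ¬ (p : ℤ) ^ 2 ∣ (p : ℤ) * m := fun m hm => not_sq_dvd_mul_of_not_dvd hm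
  have hp4' : ¬ (p : ℤ) ∣ 4 := fun h => hp2' (hpI.dvd_of_dvd_pow (show (p : ℤ) ∣ 2 ^ 2 by norm_num; exact h))
  -- `p ∤ 4r²q, 4rq, 2r²q, 2rq`
  have hn4r2q : ¬ (p : ℤ) ∣ 4 * r ^ 2 * q := fun h => by
    rcases hpI.dvd_or_dvd h with h | h
    · rcases hpI.dvd_or_dvd h with h | h
      · exact hp4' h
      · exact hpr (hpI.dvd_of_dvd_pow h)
    · exact hpq h
  have hn4rq : ¬ (p : ℤ) ∣ 4 * r * q := fun h => by
    rcases hpI.dvd_or_dvd h with h | h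
    · rcases hpI.dvd_or_dvd h with h | h
      · exact hp4' h
      · exact hpr h
    · exact hpq h
  have hn2r2q : ¬ (p : ℤ) ∣ 2 * r ^ 2 * q := fun h => by
    rcases hpI.dvd_or_dvd h with h | h
    · rcases hpI.dvd_or_dvd h with h | h
      · exact hp2' h
      · exact hpr (hpI.dvd_of_dvd_pow h)
    · exact hpq h
  have hn2rq : ¬ (p : ℤ) ∣ 2 * r * q := fun h => by
    rcases hpI.dvd_or_dvd h with h | h
    · rcases hpI.dvd_or_dvd h with h | h
      · exact hp2' h
      · exact hpr h
    · exact hpq h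
  obtain ⟨-, hrqn, -, -, -, h4r2q, h4rq, h2q, h2r2q, h2rq⟩ := nonresidues_mod_p_partner hp8 hqp hrp hQ hR hnq hsr
  -- residues mod `r` and mod `q`
  have h2r := not_isSquare_two_mod_partner (r := r) hr8
  have h20r : ((2 : ℤ) : ZMod r) ≠ 0 := fun h0 => h2r ⟨0, by rw [h0, mul_zero]⟩
  have hpmr := isSquare_p_mod_partner (p := p) (r := r) (by omega) (by rintro rfl; omega) hrp hsr
  have hqr0 : ((q : ℤ) : ZMod r) ≠ 0 := by
    intro h0
    have : (r : ℤ) ∣ q := (ZMod.intCast_zmod_eq_zero_iff_dvd q r).mp h0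
    have : r ∣ q := by exact_mod_cast this
    exact hrq ((Nat.prime_dvd_prime_iff_eq hR hQ).mp this)
  have hpr0 : ((p : ℤ) : ZMod r) ≠ 0 := by
    intro h0
    have : (r : ℤ) ∣ p := (ZMod.intCast_zmod_eq_zero_iff_dvd p r).mp h0
    have : r ∣ p := by exact_mod_cast this
    exact hrp ((Nat.prime_dvd_prime_iff_eq hR hP).mp this)
  have hq2r : IsSquare (((q : ℤ) : ZMod r) ^ 2) := ⟨_, sq _⟩
  have hq2r0 : ((q : ℤ) : ZMod r) ^ 2 ≠ 0 := pow_ne_zero 2 hqr0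
  have hpmq := isSquare_p_mod_q (p := p) (q := q) (by omega) (by omega) hnq
  have h2mq := not_isSquare_two_mod_q (q := q) hq8
  have hpq0 : ((p : ℤ) : ZMod q) ≠ 0 := by
    intro h0
    have : (q : ℤ) ∣ p := (ZMod.intCast_zmod_eq_zero_iff_dvd p q).mp h0
    have : q ∣ p := by exact_mod_cast this
    exact hqp ((Nat.prime_dvd_prime_iff_eq hQ hP).mp this)
  have hrq0 : ((r : ℤ) : ZMod q) ≠ 0 := by
    intro h0
    have : (q : ℤ) ∣ r := (ZMod.intCast_zmod_eq_zero_iff_dvd r q).mp h0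
    have : q ∣ r := by exact_mod_cast this
    exact hrq ((Nat.prime_dvd_prime_iff_eq hQ hR).mp this).symm
  have h4mq : IsSquare ((4 : ℤ) : ZMod q) := ⟨2, by push_cast; norm_num⟩
  have h4q0 : ((4 : ℤ) : ZMod q) ≠ 0 := by
    intro h0
    have : (q : ℤ) ∣ 4 := (ZMod.intCast_zmod_eq_zero_iff_dvd 4 q).mp h0
    have h' : q ∣ 2 ^ 2 := by exact_mod_cast this
    exact hq2 ((Nat.prime_dvd_prime_iff_eq hQ Nat.prime_two).mp (hQ.dvd_of_dvd_pow h'))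
  have hrec := isSquare_partner_mod_q_iff (q := q) (r := r) (by omega) hq2 hrq
  obtain ⟨hA, hB⟩ := anisotropic_partner_dual (p := p) (q := q) (r := r) hr8 hqr0 h2r hp4
  haveI : Fact (Nat.Prime 2) := ⟨Nat.prime_two⟩
  constructor
  · intro hd
    have hsq := squarefree_of_mem_twoIsogenySelmerGroup hd
    have hd0 : d ≠ 0 := hsq.ne_zero
    have hdvd : d ∣ (4 * r ^ 2 * p * q ^ 2 : ℤ) := dvd_of_mem_twoIsogenySelmerGroup hd
    have key : ∀ d' : ℤ, d * d' = (4 * r ^ 2 * p * q ^ 2 : ℤ) → (twoIsogenyQuartic 0 d d').IsLocallySoluble :=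
      fun d' hdd => isLocallySoluble_of_mem hd0 hdd hd
    rcases lt_or_gt_of_ne hd0 with hneg | hpos
    · exfalso
      obtain ⟨d', hd'⟩ := hdvd
      have hd'neg : d' < 0 := by
        rcases pos_and_pos_or_neg_and_neg_of_mul_pos (show 0 < d * d' by rw [← hd']; exact hbpos) with ⟨h1, -⟩ | ⟨-, h2⟩
        · exact absurd h1 (not_lt.mpr hneg.le)
        · exact h2
      exact not_isSoluble_real_twoIsogenyQuartic_of_neg hneg hd'neg le_rfl (key d' hd'.symm).1
    have hdabs : d = (d.natAbs : ℤ) := (Int.natAbs_of_nonneg hpos.le).symm ▸ rfl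
    rcases natAbs_eq_of_squarefree_dvd_partner' (p := p) (q := q) (r := r) hsq hdvd with (h | h | h | h) | (h | h | h | h) |
        (h | h | h | h) | (h | h | h | h) <;> rw [h] at hdabs <;> push_cast at hdabs <;> subst hdabs
    · exact Or.inl rfl
    · -- d = 2 : dies at r (`2`, `2pq²` non-residues mod r)
      refine absurd ((key (2 * r ^ 2 * p * q ^ 2) (by ring)).2 r) ?_
      refine not_isSoluble_padic_of_sq_mul (ℓ := r) (c := 2) (c' := 2 * r ^ 2 * p * q ^ 2) (c'' := 2 * p * q ^ 2)
        (by ring) h2r ?_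
      rw [show ((2 * p * q ^ 2 : ℤ) : ZMod r) = ((2 : ℤ) : ZMod r) * (((p : ℤ) : ZMod r) * ((q : ℤ) : ZMod r) ^ 2) by
        push_cast; ring]
      exact not_isSquare_mul_of_isSquare h2r (isSquare_mul' hpmr hq2r) (mul_ne_zero hpr0 hq2r0)
    · -- d = r
      by_cases hqr : IsSquare ((q : ℤ) : ZMod r)
      · refine absurd ((key (4 * r * p * q ^ 2) (by ring)).2 r) ?_
        exact not_isSoluble_padic_of_dvd_of_dvd (ℓ := r) (c := (r : ℤ)) (c' := 4 * r * p * q ^ 2) (c₀ := 1)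
          (c₀' := 4 * p * q ^ 2) (by ring) (by ring) (hA hqr).1
      · have hnr : ¬ IsSquare ((r : ℤ) : ZMod q) := fun h => hqr (hrec.mp h)
        refine absurd ((key (4 * r * p * q ^ 2) (by ring)).2 q) ?_
        refine not_isSoluble_padic_of_sq_mul (ℓ := q) (c := (r : ℤ)) (c' := 4 * r * p * q ^ 2) (c'' := 4 * r * p)
          (by ring) hnr ?_
        rw [show ((4 * r * p : ℤ) : ZMod q) = ((r : ℤ) : ZMod q) * (((4 : ℤ) : ZMod q) * ((p : ℤ) : ZMod q)) by push_cast; ring]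
        exact not_isSquare_mul_of_isSquare hnr (isSquare_mul' h4mq hpmq) (mul_ne_zero h4q0 hpq0)
    · -- d = 2r
      by_cases hqr : IsSquare ((q : ℤ) : ZMod r)
      · have hrr : IsSquare ((r : ℤ) : ZMod q) := hrec.mpr hqr
        have h2rn : ¬ IsSquare ((2 * r : ℤ) : ZMod q) := by
          rw [show ((2 * r : ℤ) : ZMod q) = ((2 : ℤ) : ZMod q) * ((r : ℤ) : ZMod q) by push_cast; ring]
          exact not_isSquare_mul_of_isSquare h2mq hrr hrq0
        refine absurd ((key (2 * r * p * q ^ 2) (by ring)).2 q) ?_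
        refine not_isSoluble_padic_of_sq_mul (ℓ := q) (c := 2 * (r : ℤ)) (c' := 2 * r * p * q ^ 2) (c'' := 2 * r * p)
          (by ring) h2rn ?_
        rw [show ((2 * r * p : ℤ) : ZMod q) = ((2 * r : ℤ) : ZMod q) * ((p : ℤ) : ZMod q) by push_cast; ring]
        exact not_isSquare_mul_of_isSquare h2rn hpmq hpq0
      · refine absurd ((key (2 * r * p * q ^ 2) (by ring)).2 r) ?_
        exact not_isSoluble_padic_of_dvd_of_dvd (ℓ := r) (c := 2 * (r : ℤ)) (c' := 2 * r * p * q ^ 2) (c₀ := 2)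
          (c₀' := 2 * p * q ^ 2) (by ring) (by ring) (hB hqr).1
    · exact Or.inr rfl
    · -- d = 2p : dies at r (`2p`, `2q²` non-residues)
      refine absurd ((key (2 * r ^ 2 * q ^ 2) (by ring)).2 r) ?_
      refine not_isSoluble_padic_of_sq_mul (ℓ := r) (c := 2 * (p : ℤ)) (c' := 2 * r ^ 2 * q ^ 2) (c'' := 2 * q ^ 2)
        (by ring) ?_ ?_
      · rw [show ((2 * p : ℤ) : ZMod r) = ((2 : ℤ) : ZMod r) * ((p : ℤ) : ZMod r) by push_cast; ring]
        exact not_isSquare_mul_of_isSquare h2r hpmr hpr0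
      · rw [show ((2 * q ^ 2 : ℤ) : ZMod r) = ((2 : ℤ) : ZMod r) * ((q : ℤ) : ZMod r) ^ 2 by push_cast; ring]
        exact not_isSquare_mul_of_isSquare h2r hq2r hq2r0
    · -- d = rp
      by_cases hqr : IsSquare ((q : ℤ) : ZMod r)
      · refine absurd ((key (4 * r * q ^ 2) (by ring)).2 r) ?_
        exact not_isSoluble_padic_of_dvd_of_dvd (ℓ := r) (c := (r : ℤ) * p) (c' := 4 * r * q ^ 2) (c₀ := (p : ℤ))
          (c₀' := 4 * q ^ 2) (by ring) (by ring) (hA hqr).2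
      · have hnr : ¬ IsSquare ((r : ℤ) : ZMod q) := fun h => hqr (hrec.mp h)
        have hrpn : ¬ IsSquare (((r : ℤ) * p : ℤ) : ZMod q) := by
          rw [show (((r : ℤ) * p : ℤ) : ZMod q) = ((r : ℤ) : ZMod q) * ((p : ℤ) : ZMod q) by push_cast; ring]
          exact not_isSquare_mul_of_isSquare hnr hpmq hpq0
        refine absurd ((key (4 * r * q ^ 2) (by ring)).2 q) ?_
        refine not_isSoluble_padic_of_sq_mul (ℓ := q) (c := (r : ℤ) * p) (c' := 4 * r * q ^ 2) (c'' := 4 * r)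
          (by ring) hrpn ?_
        rw [show ((4 * r : ℤ) : ZMod q) = ((r : ℤ) : ZMod q) * ((4 : ℤ) : ZMod q) by push_cast; ring]
        exact not_isSquare_mul_of_isSquare hnr h4mq h4q0
    · -- d = 2rp
      by_cases hqr : IsSquare ((q : ℤ) : ZMod r)
      · have hrr : IsSquare ((r : ℤ) : ZMod q) := hrec.mpr hqr
        have h2rn : ¬ IsSquare ((2 * r : ℤ) : ZMod q) := by
          rw [show ((2 * r : ℤ) : ZMod q) = ((2 : ℤ) : ZMod q) * ((r : ℤ) : ZMod q) by push_cast; ring]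
          exact not_isSquare_mul_of_isSquare h2mq hrr hrq0
        have h2rpn : ¬ IsSquare ((2 * r * p : ℤ) : ZMod q) := by
          rw [show ((2 * r * p : ℤ) : ZMod q) = ((2 * r : ℤ) : ZMod q) * ((p : ℤ) : ZMod q) by push_cast; ring]
          exact not_isSquare_mul_of_isSquare h2rn hpmq hpq0
        refine absurd ((key (2 * r * q ^ 2) (by ring)).2 q) ?_
        exact not_isSoluble_padic_of_sq_mul (ℓ := q) (c := 2 * (r : ℤ) * p) (c' := 2 * r * q ^ 2) (c'' := 2 * r)
          (by ring) h2rpn h2rn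
      · refine absurd ((key (2 * r * q ^ 2) (by ring)).2 r) ?_
        exact not_isSoluble_padic_of_dvd_of_dvd (ℓ := r) (c := 2 * (r : ℤ) * p) (c' := 2 * r * q ^ 2) (c₀ := 2 * (p : ℤ))
          (c₀' := 2 * q ^ 2) (by ring) (by ring) (hB hqr).2
    · -- d = q : dies at p
      refine absurd ((key (4 * r ^ 2 * p * q) (by ring)).2 p) ?_
      exact not_isSoluble_padic_of_dvd_right (c := (q : ℤ)) (c' := 4 * r ^ 2 * p * q) ⟨4 * r ^ 2 * q, by ring⟩
        (by rw [show (4 * r ^ 2 * p * q : ℤ) = p * (4 * r ^ 2 * q) by ring]; exact hnd _ hn4r2q) hnq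
    · -- d = 2q : dies at p
      refine absurd ((key (2 * r ^ 2 * p * q) (by ring)).2 p) ?_
      exact not_isSoluble_padic_of_dvd_right (c := 2 * (q : ℤ)) (c' := 2 * r ^ 2 * p * q) ⟨2 * r ^ 2 * q, by ring⟩
        (by rw [show (2 * r ^ 2 * p * q : ℤ) = p * (2 * r ^ 2 * q) by ring]; exact hnd _ hn2r2q) h2q
    · -- d = rq : dies at p
      refine absurd ((key (4 * r * p * q) (by ring)).2 p) ?_
      exact not_isSoluble_padic_of_dvd_right (c := (r : ℤ) * q) (c' := 4 * r * p * q) ⟨4 * r * q, by ring⟩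
        (by rw [show (4 * r * p * q : ℤ) = p * (4 * r * q) by ring]; exact hnd _ hn4rq) hrqn
    · -- d = 2rq : dies at p
      refine absurd ((key (2 * r * p * q) (by ring)).2 p) ?_
      exact not_isSoluble_padic_of_dvd_right (c := 2 * (r : ℤ) * q) (c' := 2 * r * p * q) ⟨2 * r * q, by ring⟩
        (by rw [show (2 * r * p * q : ℤ) = p * (2 * r * q) by ring]; exact hnd _ hn2rq) h2rq
    · -- d = pq : dies at p
      refine absurd ((key (4 * r ^ 2 * q) (by ring)).2 p) ?_
      exact not_isSoluble_padic_of_dvd_left (c := (p : ℤ) * q) (c' := 4 * r ^ 2 * q) ⟨q, by ring⟩ (hnd _ hpq) h4r2q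
    · -- d = 2pq : dies at p
      refine absurd ((key (2 * r ^ 2 * q) (by ring)).2 p) ?_
      exact not_isSoluble_padic_of_dvd_left (c := 2 * ((p : ℤ) * q)) (c' := 2 * r ^ 2 * q) ⟨2 * q, by ring⟩
        (by rw [show (2 * ((p : ℤ) * q)) = p * (2 * q) by ring]; exact hnd _ (fun h => (hpI.dvd_or_dvd h).elim hp2' hpq)) h2r2q
    · -- d = rpq : dies at p
      refine absurd ((key (4 * r * q) (by ring)).2 p) ?_
      exact not_isSoluble_padic_of_dvd_left (c := (r : ℤ) * (p * q)) (c' := 4 * r * q) ⟨r * q, by ring⟩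
        (by rw [show ((r : ℤ) * (p * q)) = p * (r * q) by ring]; exact hnd _ (fun h => (hpI.dvd_or_dvd h).elim hpr hpq)) h4rq
    · -- d = 2rpq : dies at p
      refine absurd ((key (2 * r * q) (by ring)).2 p) ?_
      exact not_isSoluble_padic_of_dvd_left (c := 2 * (r : ℤ) * (p * q)) (c' := 2 * r * q) ⟨2 * r * q, by ring⟩
        (by rw [show (2 * (r : ℤ) * (p * q)) = p * (2 * r * q) by ring]; exact hnd _ hn2rq) h2rq
  · rintro (rfl | rfl)
    · exact one_mem_twoIsogenySelmerGroup 0 hb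
    · refine mem_twoIsogenySelmerGroup_of_isSquare hb (Int.squarefree_natCast.mpr hP.prime.squarefree) ⟨4 * r ^ 2 * q ^ 2, by ring⟩
        ⟨2 * r * q, ?_⟩
      rw [show (4 * r ^ 2 * p * q ^ 2 : ℤ) = (p : ℤ) * (4 * r ^ 2 * q ^ 2) by ring, Int.mul_ediv_cancel_left _ hp0]
      ring

end Dual

end Summit.BirchSwinnertonDyer.BirchSwinnertonDyer.Theorems.BiquadraticEisensteinDescentHeegnerTwistCouplingInSupplyQuarticPartnerDescentDual

end
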